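import Mathlib
import Literature.Probability.Percolation.PercolationProofs
import Literature.Probability.Percolation.ConditionalPositiveAssociation
import Literature.Probability.Percolation.ConditionalPositiveAssociationProofs
import HarnessLib

/-!
# Crux `PercNearOneGluing.AdditiveGluing` (stmt-CriticalPhenomena-4576), line `replica-splice-at-entrance` —
# stub `stub_bhkSets`, auxiliary file: the hub augmentation

Helper file for the crux skeleton of the line `replica-splice-at-entrance` (lead
prover-line-stmt-CriticalPhenomena-4576-c3-0), tool for the registered stub `stub_bhkSets`
(van den Berg–Häggström–Kahn 2006, Thms. 1.3/1.4 for the open cluster of a vertex SET); lands with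
`--supports stmt-CriticalPhenomena-4576`.

## Content: the hub augmentation (the folklore reduction "cluster of a set = cluster of a hub")

Fix a finite vertex type `V`, weights `w : Sym2 V → [0, 1]` (`μ_w = prodBernoulli w`: every pair open
independently, `e` with probability `w e`) and an attachment set `A : Finset V`.  On the augmented vertex
type `Option V` (hub `none`, old vertex `x` as `some x`) put the weights `w' = hubW⟦A, w⟧`
(`w' (Sym2.map some e) = w e`, `w' s(none, some a) = 1` for `a ∈ A`, every other new pair `0`; the tree
term `Function.extend (Sym2.map some) w (fun e => if ∃ a ∈ A, e = s(none, some a) then 1 else 0)`, the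
`if` decided classically), and
the lift of a configuration `hubLift⟦A, η⟧ = Sym2.map some '' η ∪ {e | ∃ a ∈ A, e = s(none, some a)}`
(old pairs of `η` plus the hub pairs).  Both are file-local notations for these tree terms (no new
definitions), so the statements below are about the spelled-out terms.

* `bhkHub_integral`: `μ_{w'}` IS the image of `μ_w` under the lift — as the identity of finite sums
  `∫ h dμ_{w'} = ∫ h ∘ lift dμ_w` for every `h` (product weights: the weight of `lift η` is the weight
  of `η`, and configurations off the range of the lift have weight `0`);
* `bhkHub_reachable_none_some`: `none ↔ some y` in `lift η` iff `a ↔ y` in `η` for some `a ∈ A`;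
  `bhkHub_reachable_some_some`: for `x` not joined to `A`, `some x ↔ some y` in `lift η` iff `x ↔ y`;
* `bhkHub_preimage_cluster_none`: the old pairs of the open edge cluster of the hub are
  `⋃_{a ∈ A} C_a(η)`; `bhkHub_preimage_cluster_some`: for `x` not joined to `A` the old pairs of
  `C_{some x}` are `C_x(η)`.
-/

namespace Summit.CriticalPhenomena.PercolationContinuityZ3.Theorems

open MeasureTheory Set Literature.Probability.LatticeModels Literature.Probability.Percolation
open scoped Classical BigOperators

noncomputable section

variable {V : Type*}

/-! ### The lift of a configuration and the augmented weights -/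

/-- `hubLift⟦A, η⟧`, the hub lift of a configuration `η` on `V` to the augmented vertex type
`Option V`: the old pairs of `η` (through `some`) together with the hub pairs `s(none, some a)`, `a ∈ A`
(file-local notation for the tree term `Sym2.map some '' η ∪ {e | ∃ a ∈ A, e = s(none, some a)}`). -/
local notation3 (prettyPrint := false) "hubLift⟦" A ", " η "⟧" =>
  (Sym2.map some '' η ∪ {e | ∃ a ∈ A, e = s(none, some a)})

/-- `hubW⟦A, w⟧`, the augmented weights: `w` on the old pairs, `1` on the hub pairs `s(none, some a)`,
`a ∈ A`, and `0` on every other pair containing the hub (file-local notation for the tree term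
`Function.extend (Sym2.map some) w (fun e => if ∃ a ∈ A, e = s(none, some a) then 1 else 0)`, the `if`
decided classically so that the term does not depend on the ambient decidability instances). -/
local notation3 (prettyPrint := false) "hubW⟦" A ", " w "⟧" =>
  (Function.extend (Sym2.map some) w fun e =>
    @ite unitInterval (∃ a ∈ A, e = s(none, some a)) (Classical.dec _) 1 0)

/-- `Sym2.map some` is injective. -/
theorem bhkHub_map_injective : Function.Injective (Sym2.map (some : V → Option V)) :=
  Sym2.map.injective (Option.some_injective V)

/-- The hub lies on no old pair. -/
theorem bhkHub_none_not_mem_map (e : Sym2 V) : (none : Option V) ∉ Sym2.map some e := by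
  intro h
  obtain ⟨x, -, hx⟩ := Sym2.mem_map.1 h
  exact Option.some_ne_none x hx

/-- Every pair of `Option V` is an old pair or contains the hub. -/
theorem bhkHub_cases (e' : Sym2 (Option V)) :
    (∃ e : Sym2 V, e' = Sym2.map some e) ∨ ∃ v : Option V, e' = s(none, v) := by
  induction e' using Sym2.ind with
  | h x y =>
    cases x with
    | none => exact Or.inr ⟨y, rfl⟩
    | some x =>
      cases y with
      | none => exact Or.inr ⟨some x, Sym2.eq_swap⟩
      | some y => exact Or.inl ⟨s(x, y), by simp⟩

/-- An old pair lies in the lift iff it lies in the configuration. -/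
@[simp] theorem bhkHub_map_mem_lift {A : Finset V} {η : Set (Sym2 V)} {e : Sym2 V} :
    Sym2.map some e ∈ hubLift⟦A, η⟧ ↔ e ∈ η := by
  constructor
  · rintro (⟨e', he', hee'⟩ | ⟨a, -, hae⟩)
    · exact bhkHub_map_injective hee' ▸ he'
    · exact absurd (hae ▸ Sym2.mem_mk_left none (some a)) (bhkHub_none_not_mem_map e)
  · exact fun he => Or.inl ⟨e, he, rfl⟩

/-- An old pair `s(some x, some y)` lies in the lift iff `s(x, y)` lies in the configuration. -/
@[simp] theorem bhkHub_mk_mem_lift {A : Finset V} {η : Set (Sym2 V)} {x y : V} :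
    s(some x, some y) ∈ hubLift⟦A, η⟧ ↔ s(x, y) ∈ η := by
  rw [← bhkHub_map_mem_lift (A := A), Sym2.map_mk]

/-- A hub pair `s(none, some a)` lies in the lift iff `a ∈ A`. -/
@[simp] theorem bhkHub_hub_mem_lift {A : Finset V} {η : Set (Sym2 V)} {a : V} :
    s(none, some a) ∈ hubLift⟦A, η⟧ ↔ a ∈ A := by
  constructor
  · rintro (⟨e', -, hee'⟩ | ⟨a', ha', haa'⟩)
    · exact absurd (hee' ▸ Sym2.mem_mk_left none (some a)) (bhkHub_none_not_mem_map e')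
    · have h : some a ∈ s(none, some a') := haa' ▸ Sym2.mem_mk_right none (some a)
      rcases Sym2.mem_iff.1 h with h | h
      · exact absurd h (Option.some_ne_none a)
      · rwa [Option.some_injective _ h]
  · exact fun ha => Or.inr ⟨a, ha, rfl⟩

/-- The hub loop is not in the lift. -/
@[simp] theorem bhkHub_loop_not_mem_lift {A : Finset V} {η : Set (Sym2 V)} :
    s(none, none) ∉ hubLift⟦A, η⟧ := by
  rintro (⟨e', -, hee'⟩ | ⟨a', -, haa'⟩)
  · exact bhkHub_none_not_mem_map e' (hee' ▸ Sym2.mem_mk_left none none)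
  · have h : some a' ∈ s((none : Option V), none) := haa' ▸ Sym2.mem_mk_right none (some a')
    rcases Sym2.mem_iff.1 h with h | h <;> exact Option.some_ne_none a' h

/-- The old pairs of the lift are the configuration. -/
theorem bhkHub_preimage_lift (A : Finset V) (η : Set (Sym2 V)) :
    Sym2.map some ⁻¹' hubLift⟦A, η⟧ = η := by
  ext e
  rw [mem_preimage, bhkHub_map_mem_lift]

/-- The lift is injective. -/
theorem bhkHub_lift_injective (A : Finset V) :
    Function.Injective fun η : Set (Sym2 V) => hubLift⟦A, η⟧ := by
  intro η₁ η₂ h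
  have h' : hubLift⟦A, η₁⟧ = hubLift⟦A, η₂⟧ := h
  rw [← bhkHub_preimage_lift A η₁, h', bhkHub_preimage_lift]

/-- The augmented weight of an old pair. -/
@[simp] theorem bhkHubWeight_map (A : Finset V) (w : Sym2 V → unitInterval) (e : Sym2 V) :
    hubW⟦A, w⟧ (Sym2.map some e) = w e :=
  bhkHub_map_injective.extend_apply _ _ e

/-- The augmented weight of a pair containing the hub. -/
theorem bhkHubWeight_of_none_mem (A : Finset V) (w : Sym2 V → unitInterval) {e' : Sym2 (Option V)}
    (he' : none ∈ e') :
    hubW⟦A, w⟧ e' = @ite unitInterval (∃ a ∈ A, e' = s(none, some a)) (Classical.dec _) 1 0 := by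
  refine Function.extend_apply' _ _ _ ?_
  rintro ⟨e, rfl⟩
  exact bhkHub_none_not_mem_map e he'

/-- The augmented weight of a hub pair `s(none, some a)`, `a ∈ A`, is `1`. -/
theorem bhkHubWeight_hub (A : Finset V) (w : Sym2 V → unitInterval) {a : V} (ha : a ∈ A) :
    hubW⟦A, w⟧ s(none, some a) = 1 := by
  rw [bhkHubWeight_of_none_mem A w (Sym2.mem_mk_left _ _), if_pos ⟨a, ha, rfl⟩]

/-- The augmented weight of a hub pair `s(none, some a)`, `a ∉ A`, is `0`. -/
theorem bhkHubWeight_hub_of_not_mem (A : Finset V) (w : Sym2 V → unitInterval) {a : V}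
    (ha : a ∉ A) : hubW⟦A, w⟧ s(none, some a) = 0 := by
  rw [bhkHubWeight_of_none_mem A w (Sym2.mem_mk_left _ _), if_neg]
  rintro ⟨a', ha', h⟩
  have h' : some a ∈ s(none, some a') := h ▸ Sym2.mem_mk_right none (some a)
  rcases Sym2.mem_iff.1 h' with h' | h'
  · exact Option.some_ne_none a h'
  · exact ha (Option.some_injective _ h' ▸ ha')

/-- The augmented weight of the hub loop is `0`. -/
theorem bhkHubWeight_loop (A : Finset V) (w : Sym2 V → unitInterval) :
    hubW⟦A, w⟧ s(none, none) = 0 := by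
  rw [bhkHubWeight_of_none_mem A w (Sym2.mem_mk_left _ _), if_neg]
  rintro ⟨a', -, h⟩
  have h' : some a' ∈ s((none : Option V), none) := h ▸ Sym2.mem_mk_right none (some a')
  rcases Sym2.mem_iff.1 h' with h' | h' <;> exact Option.some_ne_none a' h'

/-! ### The law of the lift: product weights -/

section Weights

variable [Fintype V]

/-- The product weight of the lift of `η` (augmented weights) is the product weight of `η`. -/
theorem bhkHub_weight_lift (A : Finset V) (w : Sym2 V → unitInterval) (η : Set (Sym2 V)) :
    BHK2006.weight (fun e' => (hubW⟦A, w⟧ e' : ℝ)) (hubLift⟦A, η⟧) =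
      BHK2006.weight (fun e => (w e : ℝ)) η := by
  unfold BHK2006.weight
  rw [← Finset.prod_subset (Finset.subset_univ (Finset.univ.image (Sym2.map some))),
    Finset.prod_image fun _ _ _ _ h => bhkHub_map_injective h]
  · refine Finset.prod_congr rfl fun e _ => ?_
    simp only [bhkHubWeight_map, bhkHub_map_mem_lift]
  · intro e' _ he'
    beta_reduce
    rcases bhkHub_cases e' with ⟨e, rfl⟩ | ⟨v, rfl⟩
    · exact absurd (Finset.mem_image_of_mem _ (Finset.mem_univ e)) he'
    · cases v with
      | none => rw [if_neg bhkHub_loop_not_mem_lift, bhkHubWeight_loop]; simp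
      | some a =>
        by_cases ha : a ∈ A
        · rw [if_pos (bhkHub_hub_mem_lift.2 ha), bhkHubWeight_hub A w ha]; simp
        · rw [if_neg (mt bhkHub_hub_mem_lift.1 ha), bhkHubWeight_hub_of_not_mem A w ha]; simp

/-- A configuration of the augmented type which is not a lift has augmented weight `0` (it misses
a weight-`1` hub pair or contains a weight-`0` pair). -/
theorem bhkHub_weight_eq_zero (A : Finset V) (w : Sym2 V → unitInterval)
    {ω' : Set (Sym2 (Option V))} (hω' : ∀ η, hubLift⟦A, η⟧ ≠ ω') :
    BHK2006.weight (fun e' => (hubW⟦A, w⟧ e' : ℝ)) ω' = 0 := by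
  by_contra hne
  have hfac : ∀ e' : Sym2 (Option V),
      (if e' ∈ ω' then (hubW⟦A, w⟧ e' : ℝ) else 1 - hubW⟦A, w⟧ e') ≠ 0 :=
    fun e' h => hne (Finset.prod_eq_zero (Finset.mem_univ e') h)
  refine hω' (Sym2.map some ⁻¹' ω') (Set.ext fun e' => ?_)
  rcases bhkHub_cases e' with ⟨e, rfl⟩ | ⟨v, rfl⟩
  · rw [bhkHub_map_mem_lift, mem_preimage]
  · cases v with
    | none =>
      simp only [bhkHub_loop_not_mem_lift, false_iff]
      intro hmem
      refine hfac s(none, none) ?_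
      rw [if_pos hmem, bhkHubWeight_loop]
      simp
    | some a =>
      by_cases ha : a ∈ A
      · simp only [bhkHub_hub_mem_lift, ha, true_iff]
        by_contra hmem
        refine hfac s(none, some a) ?_
        rw [if_neg hmem, bhkHubWeight_hub A w ha]
        simp
      · simp only [bhkHub_hub_mem_lift, ha, false_iff]
        intro hmem
        refine hfac s(none, some a) ?_
        rw [if_pos hmem, bhkHubWeight_hub_of_not_mem A w ha]
        simp

/-- **The law of the lift.**  `prodBernoulli hubW⟦A, w⟧` is the image of `prodBernoulli w`
under the lift: `∫ h dμ_{w'} = ∫ h ∘ lift dμ_w` for every `h` (finite sums of product weights). -/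
theorem bhkHub_integral (A : Finset V) (w : Sym2 V → unitInterval) (h : Set (Sym2 (Option V)) → ℝ) :
    ∫ ω', h ω' ∂(prodBernoulli hubW⟦A, w⟧) = ∫ η, h (hubLift⟦A, η⟧) ∂(prodBernoulli w) := by
  rw [BHK2006.integral_prodBernoulli_eq_sum, BHK2006.integral_prodBernoulli_eq_sum]
  symm
  calc ∑ η, BHK2006.weight (fun e => (w e : ℝ)) η * h (hubLift⟦A, η⟧)
      = ∑ η, BHK2006.weight (fun e' => (hubW⟦A, w⟧ e' : ℝ)) (hubLift⟦A, η⟧) *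
          h (hubLift⟦A, η⟧) := by simp_rw [bhkHub_weight_lift]
    _ = ∑ ω' ∈ Finset.univ.image fun η : Set (Sym2 V) => hubLift⟦A, η⟧,
          BHK2006.weight (fun e' => (hubW⟦A, w⟧ e' : ℝ)) ω' * h ω' :=
        (Finset.sum_image (f := fun ω' => BHK2006.weight (fun e' => (hubW⟦A, w⟧ e' : ℝ)) ω' * h ω')
          fun η₁ _ η₂ _ hh => bhkHub_lift_injective A hh).symm
    _ = ∑ ω', BHK2006.weight (fun e' => (hubW⟦A, w⟧ e' : ℝ)) ω' * h ω' :=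
        Finset.sum_subset (Finset.subset_univ _) fun ω' _ hω' => by
          rw [bhkHub_weight_eq_zero A w fun η hη =>
            hω' (Finset.mem_image.2 ⟨η, Finset.mem_univ _, hη⟩), zero_mul]

/-- **The law of the lift** (registered sub-goal `stub_bhkSetsHubLaw` of the stub `stub_bhkSets`; the
statement of `bhkHub_integral` with the notations spelled out): for every finite vertex type `V`,
attachment set `A`, weights `w` and integrand `h`, `∫ h dμ_{w'} = ∫ h ∘ lift dμ_w`. -/
theorem stub_bhkSetsHubLaw : ∀ (V : Type) [Fintype V] (A : Finset V) (w : Sym2 V → unitInterval) (h : Set (Sym2 (Option V)) → ℝ), ∫ ω', h ω' ∂(Literature.Probability.LatticeModels.prodBernoulli (Function.extend (Sym2.map some) w fun e => @ite unitInterval (∃ a ∈ A, e = s(none, some a)) (Classical.dec _) 1 0)) = ∫ η, h (Sym2.map some '' η ∪ {e | ∃ a ∈ A, e = s(none, some a)}) ∂(Literature.Probability.LatticeModels.prodBernoulli w) :=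
  fun _ _ A w h => bhkHub_integral A w h

end Weights

/-! ### Connectivity of the lift -/

/-- Adjacency of two old vertices in the lift is adjacency in the configuration. -/
theorem bhkHub_adj_some_some {A : Finset V} {η : Set (Sym2 V)} {x y : V} :
    (openGraph (hubLift⟦A, η⟧)).Adj (some x) (some y) ↔ (openGraph η).Adj x y := by
  rw [openGraph_adj, openGraph_adj, bhkHub_mk_mem_lift, (Option.some_injective V).ne_iff]

/-- The hub is adjacent exactly to the attachment set. -/
theorem bhkHub_adj_none_some {A : Finset V} {η : Set (Sym2 V)} {y : V} :
    (openGraph (hubLift⟦A, η⟧)).Adj none (some y) ↔ y ∈ A := by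
  rw [openGraph_adj, bhkHub_hub_mem_lift]
  exact ⟨fun h => h.1, fun h => ⟨h, Option.some_ne_none y |>.symm⟩⟩

/-- The hub is adjacent exactly to the attachment set (symmetric form). -/
theorem bhkHub_adj_some_none {A : Finset V} {η : Set (Sym2 V)} {x : V} :
    (openGraph (hubLift⟦A, η⟧)).Adj (some x) none ↔ x ∈ A := by
  rw [SimpleGraph.adj_comm, bhkHub_adj_none_some]

/-- An open path of the configuration is an open path of old vertices in the lift. -/
theorem bhkHub_reachable_map {A : Finset V} {η : Set (Sym2 V)} {x y : V}
    (h : (openGraph η).Reachable x y) :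
    (openGraph (hubLift⟦A, η⟧)).Reachable (some x) (some y) :=
  h.map (⟨some, fun hab => bhkHub_adj_some_some.2 hab⟩ : openGraph η →g openGraph (hubLift⟦A, η⟧))

/-- A vertex joined to the attachment set is joined to the hub in the lift. -/
theorem bhkHub_reachable_none_of {A : Finset V} {η : Set (Sym2 V)} {a y : V} (ha : a ∈ A)
    (h : (openGraph η).Reachable a y) : (openGraph (hubLift⟦A, η⟧)).Reachable none (some y) :=
  (SimpleGraph.Adj.reachable (bhkHub_adj_none_some.2 ha)).trans (bhkHub_reachable_map h)

/-- The connection relation of the lift, read on the configuration (induction along an open walk):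
two old vertices are joined only if they are joined in `η` or both are joined to `A`; the hub is
joined only to vertices joined to `A`. -/
theorem bhkHub_rel_of_reachable {A : Finset V} {η : Set (Sym2 V)} {u v : Option V}
    (h : (openGraph (hubLift⟦A, η⟧)).Reachable u v) :
    (∃ x y, u = some x ∧ v = some y ∧ (openGraph η).Reachable x y) ∨
      ((∀ x, u = some x → ∃ a ∈ A, (openGraph η).Reachable a x) ∧
        ∀ y, v = some y → ∃ a ∈ A, (openGraph η).Reachable a y) := by
  rw [SimpleGraph.reachable_iff_reflTransGen] at h
  induction h with
  | refl =>
    cases u with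
    | none =>
      exact Or.inr ⟨fun x hx => (Option.some_ne_none x hx.symm).elim,
        fun x hx => (Option.some_ne_none x hx.symm).elim⟩
    | some x => exact Or.inl ⟨x, x, rfl, rfl, SimpleGraph.Reachable.refl x⟩
  | @tail b c _ hbc ih =>
    cases b with
    | none =>
      cases c with
      | none => exact absurd hbc (SimpleGraph.irrefl _)
      | some xc =>
        have hc : xc ∈ A := bhkHub_adj_none_some.1 hbc
        rcases ih with ⟨x, y, -, hy, -⟩ | ⟨hu, -⟩
        · exact (Option.some_ne_none y hy.symm).elim
        · refine Or.inr ⟨hu, fun y hy => ⟨xc, hc, ?_⟩⟩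
          cases hy
          exact SimpleGraph.Reachable.refl xc
    | some xb =>
      cases c with
      | none =>
        have hb : xb ∈ A := bhkHub_adj_some_none.1 hbc
        rcases ih with ⟨x, y, hx, hy, hxy⟩ | ⟨hu, -⟩
        · cases hy
          refine Or.inr ⟨fun x' hx' => ⟨xb, hb, ?_⟩,
            fun y hy => (Option.some_ne_none y hy.symm).elim⟩
          rw [hx] at hx'
          cases hx'
          exact hxy.symm
        · exact Or.inr ⟨hu, fun y hy => (Option.some_ne_none y hy.symm).elim⟩
      | some xc =>
        have hbc' : (openGraph η).Adj xb xc := bhkHub_adj_some_some.1 hbc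
        rcases ih with ⟨x, y, hx, hy, hxy⟩ | ⟨hu, hb⟩
        · cases hy
          exact Or.inl ⟨x, xc, hx, rfl, hxy.trans hbc'.reachable⟩
        · obtain ⟨a, ha, hab⟩ := hb xb rfl
          refine Or.inr ⟨hu, fun y hy => ?_⟩
          cases hy
          exact ⟨a, ha, hab.trans hbc'.reachable⟩

/-- **The hub is joined to `some y` iff some attachment vertex is joined to `y`.** -/
theorem bhkHub_reachable_none_some {A : Finset V} {η : Set (Sym2 V)} {y : V} :
    (openGraph (hubLift⟦A, η⟧)).Reachable none (some y) ↔
      ∃ a ∈ A, (openGraph η).Reachable a y := by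
  refine ⟨fun h => ?_, fun ⟨_, ha, hay⟩ => bhkHub_reachable_none_of ha hay⟩
  rcases bhkHub_rel_of_reachable h with ⟨x, y', hx, -, -⟩ | ⟨-, hy⟩
  · exact (Option.some_ne_none x hx.symm).elim
  · exact hy y rfl

/-- **For `x` not joined to the attachment set, `some x ↔ some y` in the lift iff `x ↔ y`.** -/
theorem bhkHub_reachable_some_some {A : Finset V} {η : Set (Sym2 V)} {x y : V}
    (hx : ¬ ∃ a ∈ A, (openGraph η).Reachable a x) :
    (openGraph (hubLift⟦A, η⟧)).Reachable (some x) (some y) ↔ (openGraph η).Reachable x y := by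
  refine ⟨fun h => ?_, bhkHub_reachable_map⟩
  rcases bhkHub_rel_of_reachable h with ⟨x', y', hx', hy', hxy⟩ | ⟨hu, -⟩
  · cases hx'
    cases hy'
    exact hxy
  · exact absurd (hu x rfl) hx

/-! ### Open edge clusters of the lift -/

/-- **The old pairs of the open edge cluster of the hub are `⋃_{a ∈ A} C_a`.** -/
theorem bhkHub_preimage_cluster_none (A : Finset V) (η : Set (Sym2 V)) :
    Sym2.map some ⁻¹' openEdgeCluster (hubLift⟦A, η⟧) none = ⋃ a ∈ A, openEdgeCluster η a := by
  ext e
  induction e using Sym2.ind with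
  | h x y =>
    simp only [mem_preimage, Sym2.map_mk, mem_iUnion, mem_openEdgeCluster_iff, bhkHub_mk_mem_lift,
      Sym2.mk_isDiag_iff, Option.some.injEq, Sym2.mem_iff, forall_eq_or_imp, forall_eq,
      bhkHub_reachable_none_some, exists_prop]
    constructor
    · rintro ⟨he, hxy, ⟨a, ha, hax⟩, -⟩
      exact ⟨a, ha, he, hxy, hax, hax.trans (SimpleGraph.Adj.reachable ((openGraph_adj η x y).2
        ⟨he, hxy⟩))⟩
    · rintro ⟨a, ha, he, hxy, hax, hay⟩
      exact ⟨he, hxy, ⟨a, ha, hax⟩, ⟨a, ha, hay⟩⟩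

/-- **For `x` not joined to the attachment set, the old pairs of `C_{some x}` are `C_x`.** -/
theorem bhkHub_preimage_cluster_some {A : Finset V} {η : Set (Sym2 V)} {x : V}
    (hx : ¬ ∃ a ∈ A, (openGraph η).Reachable a x) :
    Sym2.map some ⁻¹' openEdgeCluster (hubLift⟦A, η⟧) (some x) = openEdgeCluster η x := by
  ext e
  induction e using Sym2.ind with
  | h u v =>
    simp only [mem_preimage, Sym2.map_mk, mem_openEdgeCluster_iff, bhkHub_mk_mem_lift,
      Sym2.mk_isDiag_iff, Option.some.injEq, Sym2.mem_iff, forall_eq_or_imp, forall_eq,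
      bhkHub_reachable_some_some hx]

end

end Summit.CriticalPhenomena.PercolationContinuityZ3.Theorems
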